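import Summits.BirchSwinnertonDyer.BirchSwinnertonDyer.Theorems.KimAtThreeShallowEqDeepGoodCoreVertexRat
import Summits.BirchSwinnertonDyer.Rank1Residual.GaloisImage.KolyvaginPropagatedLevelCount
import Summits.BirchSwinnertonDyer.Rank1Residual.GaloisImage.PropagatedStructureKummer
import HarnessLib

/-!
# Route `KimAtThreeKolyvagin` (rung W2), crux `ShallowEqDeepAtTorsionFree` (stmt-BirchSwinnertonDyer-19077):
# the good core vertex IS a core vertex — residual level (`λ^*(d) = 0` for `𝓕̄_can(d)`) and depth
# (`H¹_{𝓕_can(d)^*}(ℚ, E[p^{k+1}]^D) = 0`, `H¹_{𝓕_can(d)}(ℚ, E[p^{k+1}]) ≅ ℤ/p^{k+1}` through `Λ ∘ loc_p`)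

Cell `bsd-addord`, seat `bsd-addord-w2-c4` (D-0074 row B7), gen 3; fourth file of the GOOD CORE VERTEX
port (siblings `KimAtThreeShallowEqDeepGoodCoreVertex{,Rat,Devissage}`).  TOOL theorems only (no
definition, no named fact, no `sorry`); nothing asserted about any particular curve; nothing booked.

* §9 `atLevel_mono`; **`dualSelmerGroup_propagatedOne_atLevel_eq_bot_of_kummer`**: if the dual Selmer
  group of the level-`d` KUMMER structure on `E[p]` vanishes (files 1–2), so does that of the level-`d`
  residual CANONICAL structure `𝓕̄_can(d)` (`𝓚 ≤ 𝓕̄_can`, duality reverses inclusions): `d` is a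
  CORE VERTEX of `(E[p], 𝓕̄_can, 𝒫)` in the sense of Rubin Def. 2.5.3 / Sakamoto §6 (`λ^*(d) = 0`) —
  the hypothesis of n1011's `m = 1` structure theorems (`CoreRankOne.bijective_eval_of_core`,
  `KolyvaginCoreGraphConnected.apply_eq_zero_of_apply_core_eq_zero`) at the vertex `d`.
* §10 **`coreVertex_of_kummer_atLevel_eq_bot`**: at depth `k + 1`, if `H¹_{𝓚(d)}(ℚ, E[p^{k+1}]) = 0`
  (file 3) then, by n1011's Poitou–Tate count at the level `d`
  (`DeepLedger.natCard_selmerGroup_propagated_atLevel_eq`: `#H¹_{𝓕_can(d)} = p^{k+1} · #H¹_{𝓕_can(d)^*}`)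
  and the injectivity of `Λ ∘ loc_p` (file 2 §5): `H¹_{𝓕_can(d)^*}(ℚ, E[p^{k+1}]^D) = 0`,
  `#H¹_{𝓕_can(d)}(ℚ, E[p^{k+1}]) = p^{k+1}`, and `Λ ∘ loc_p : H¹_{𝓕_can(d)} → ℤ/p^{k+1}` is a bijection —
  `d` is a core vertex of the DEPTH datum with `H¹_{𝓕_can(d)}` cyclic of order `p^{k+1}`.
What remains for EndCore's `hord` (`addOrderOf (g d) = p^{k+1}`): that the generator `g` of `KS₁`
generates `H¹_{𝓕_can(d)}` at `d` — [S24] Thm. 4.4 (1)'s bijectivity, or n1011's injectivity of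
evaluation at all depths (`KolyvaginInjectivityAllDepths`) + `#KS₁ = p^{k+1}`.  Not here.
References: [Rubin2011] Def. 2.5.3, Ex. 2.5.4, Cor. 2.7.3; [MazurRubin2004] Prop. 2.3.5, Def. 4.1.8,
Cor. 4.1.9; [Sakamoto2024] §6; [Kim2022StructureSelmer] Prop. 3.12.
-/

set_option autoImplicit false
-- the Theorems namespace of a single-conjunct summit repeats the summit name by design (D-0017)
set_option linter.dupNamespace false

noncomputable section

open scoped Classical NumberField ContRepresentation
open Function Field NumberField IsDedekindDomain
open Literature.NumberTheory.GaloisRepresentations Literature.NumberTheory.GaloisRepresentations.DiscreteGaloisModule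
  Literature.NumberTheory.GaloisCohomology
open Summit.BirchSwinnertonDyer.Rank1Residual.GaloisImage
open Summit.BirchSwinnertonDyer.Rank1Residual.GaloisImage.CoreRankZero
open Summit.BirchSwinnertonDyer.Rank1Residual.X11b.Levels

universe u

namespace Summit.BirchSwinnertonDyer.BirchSwinnertonDyer.Theorems.KimAtThreeShallowEqDeepGoodCoreVertex

/-! ## §9. Monotonicity along the levels; the core vertex at the residual level -/

section Mono

variable {K : Type u} [Field K] [NumberField K]
variable {M : Type u} [AddCommGroup M] [TopologicalSpace M] [DiscreteTopology M] [Finite M]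
variable {ρ : DiscreteGaloisModule K M}

omit [Finite M] in
/-- `𝓕 ≤ 𝓖 ⟹ 𝓕(d) ≤ 𝓖(d)` (the transverse conditions at `d` are the datum's for both).
[cite: Sakamoto2024, Def. 3.3 (p. 922)] -/
theorem atLevel_mono (D : KolyvaginDatum ρ) {𝓕 𝓖 : SelmerStructure ρ} (h : 𝓕 ≤ 𝓖)
    (d : Finset (HeightOneSpectrum (𝓞 K))) : D.atLevel 𝓕 d ≤ D.atLevel 𝓖 d := by
  intro v
  rcases v with w | q
  · rw [Level.atLevel_inl, Level.atLevel_inl]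
    exact h _
  · by_cases hq : q ∈ d
    · rw [Level.atLevel_inr_of_mem D _ hq, Level.atLevel_inr_of_mem D _ hq]
    · rw [Level.atLevel_inr_of_not_mem D _ hq, Level.atLevel_inr_of_not_mem D _ hq]
      exact h _

/-- `𝓕 ≤ 𝓖` and `H¹_{𝓕(d)^*}(K, M^D) = 0` give `H¹_{𝓖(d)^*}(K, M^D) = 0` (duality reverses the order,
`selmerGroup_dualSelmerStructure_anti`). [cite: Howard2004HeegnerKolyvagin, Thm. 2.1.11] -/
theorem dualSelmerGroup_atLevel_eq_bot_of_le {n : ℕ} (inv : LocalInvariants K n) (D : KolyvaginDatum ρ)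
    {𝓕 𝓖 : SelmerStructure ρ} (h : 𝓕 ≤ 𝓖) (d : Finset (HeightOneSpectrum (𝓞 K)))
    (hbot : (inv.dualSelmerStructure ρ (D.atLevel 𝓕 d)).selmerGroup = ⊥) :
    (inv.dualSelmerStructure ρ (D.atLevel 𝓖 d)).selmerGroup = ⊥ :=
  le_bot_iff.1 (hbot ▸ inv.selmerGroup_dualSelmerStructure_anti ρ (atLevel_mono D h d))

end Mono

section ResidualCore

open WeierstrassCurve Literature.NumberTheory.EllipticCurves

variable (W : WeierstrassCurve ℚ) [W.IsElliptic] (p : ℕ) [hp : Fact p.Prime]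

/-- **The good core vertex is a core vertex of `(E[p], 𝓕̄_can, 𝒫)`** (`λ^*(d) = 0`, Rubin Def. 2.5.3
/ Sakamoto §6): the classical structure lies below the residual canonical one
(`kummerSelmerStructure_le_propagatedSelmerStructureOne`), so the vanishing of the dual Selmer group
of `𝓚(d)` (files 1–2: `exists_superset_kummerSelmerGroup_eq_bot_…`) gives that of `𝓕̄_can(d)`.
[cite: Rubin2011, Def. 2.5.3 and Cor. 2.7.3 (pp. 21–24)] [cite: Sakamoto2024, §6 (p. 930)] -/
theorem dualSelmerGroup_propagatedOne_atLevel_eq_bot_of_kummer [Finite (geomTorsion W (p : ℤ))]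
    (inv : LocalInvariants ℚ p)
    (D : KolyvaginDatum (W.torsionGaloisModule (p : ℤ))) (d : Finset (HeightOneSpectrum (𝓞 ℚ)))
    (hbot : (inv.dualSelmerStructure (W.torsionGaloisModule (p : ℤ))
      (D.atLevel (W.kummerSelmerStructure (p : ℤ)) d)).selmerGroup = ⊥) :
    (inv.dualSelmerStructure (W.torsionGaloisModule (p : ℤ))
      (D.atLevel (propagatedSelmerStructureOne W p) d)).selmerGroup = ⊥ :=
  dualSelmerGroup_atLevel_eq_bot_of_le inv D
    (fun v => KummerCondition.kummerSelmerStructure_le_propagatedSelmerStructureOne W p v) d hbot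

end ResidualCore

/-! ## §10. The core vertex at depth `k + 1`: `H¹_{𝓕_can(d)^*} = 0` and `H¹_{𝓕_can(d)} ≅ ℤ/p^{k+1}` -/

section DepthCore

open WeierstrassCurve Literature.NumberTheory.EllipticCurves

variable (W : WeierstrassCurve ℚ) [W.IsElliptic] (p : ℕ) [hp : Fact p.Prime] (k : ℕ)

/-- **The good core vertex is a core vertex of the DEPTH datum, with `H¹_{𝓕_can(d)}(ℚ, E[p^{k+1}])`
cyclic of order `p^{k+1}` identified with `ℤ/p^{k+1}` by `Λ ∘ loc_{v_p}`.**  Binders: those of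
n1011's level count `DeepLedger.natCard_selmerGroup_propagated_atLevel_eq` (the dictionary functional
`Λ` onto `ℤ/p^{k+1}` with the Kummer kernel clause; a Poitou–Tate family at the modulus `p^{k+1}`;
Tate's `hEP`; an admissible `T ∋ v_p` with `𝓕_can`, `𝓚` unramified outside it; `Sel_{p^{k+1}}(E/ℚ)`
finite; the datum's primes off `T` with `#H¹_ur = #𝒯`), plus the level `d ∌ v_p` and the vanishing
`H¹_{𝓚(d)}(ℚ, E[p^{k+1}]) = 0` (file 3).  THEN (i) `H¹_{𝓕_can(d)^*}(ℚ, E[p^{k+1}]^D) = 0`, (ii)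
`#H¹_{𝓕_can(d)}(ℚ, E[p^{k+1}]) = p^{k+1}`, (iii) `Λ ∘ loc_{v_p}` maps `H¹_{𝓕_can(d)}` ONTO `ℤ/p^{k+1}`
(it is injective by file 2 §5, and `#H¹_{𝓕_can(d)} = p^{k+1} · #H¹_{𝓕_can(d)^*} ≤ p^{k+1}`).
[cite: MazurRubin2004, Prop. 2.3.5, Def. 4.1.8, Cor. 4.1.9] [cite: Rubin2011, Ex. 2.5.4 (p. 21)]
[cite: Kim2022StructureSelmer, Prop. 3.12] -/
theorem coreVertex_of_kummer_atLevel_eq_bot (hp2 : p ≠ 2) {v₀ : HeightOneSpectrum (𝓞 ℚ)}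
    (hv₀ : ((p : ℕ) : 𝓞 ℚ) ∈ v₀.asIdeal)
    [Finite (geomTorsion W ((p : ℤ) ^ k * (p : ℤ)))]
    (Λ : galoisCohomology ((W.torsionGaloisModule ((p : ℤ) ^ k * (p : ℤ))).toLocal (Sum.inr v₀)) 1
      →+ ZMod (p ^ (k + 1)))
    (hon : ∀ r : ZMod (p ^ (k + 1)), ∃ x ∈ propagatedSelmerStructure W p k (Sum.inr v₀), Λ x = r)
    (hker : ∀ x ∈ propagatedSelmerStructure W p k (Sum.inr v₀),
      Λ x = 0 ↔ x ∈ W.kummerSelmerStructure ((p : ℤ) ^ k * (p : ℤ)) (Sum.inr v₀))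
    (inv : LocalInvariants ℚ (p ^ (k + 1))) (hperf : inv.IsPerfect) (hsum : inv.SumLocalTermEqZero)
    (hcompl : inv.SelmerComplement)
    (hinj : ∀ v : HeightOneSpectrum (𝓞 ℚ), Injective (inv (Sum.inr v)))
    (hEP : ∀ v : HeightOneSpectrum (𝓞 ℚ), localEulerPoincareCharacteristic (v.adicCompletion ℚ))
    (T : Finset (HeightOneSpectrum (𝓞 ℚ))) (hv₀T : v₀ ∈ T)
    (hT : ∀ v : HeightOneSpectrum (𝓞 ℚ), v ∉ T →
      (((p ^ (k + 1) : ℕ) : ℕ) : 𝓞 ℚ) ∉ v.asIdeal ∧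
        GaloisRep.IsUnramifiedAt v (W.torsionGaloisModule ((p : ℤ) ^ k * (p : ℤ))))
    (h𝓕T : (propagatedSelmerStructure W p k).IsUnramifiedOutside (finSupport T))
    (h𝓚T : (W.kummerSelmerStructure ((p : ℤ) ^ k * (p : ℤ))).IsUnramifiedOutside (finSupport T))
    [Finite (W.kummerSelmerStructure ((p : ℤ) ^ k * (p : ℤ))).selmerGroup]
    (D : KolyvaginDatum (W.torsionGaloisModule ((p : ℤ) ^ k * (p : ℤ))))
    (hPS : ∀ q ∈ D.primes, q ∉ T)
    (hUT : ∀ q ∈ D.primes,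
      Nat.card (unramifiedSubgroup (GaloisRep.toLocal q (W.torsionGaloisModule ((p : ℤ) ^ k * (p : ℤ)))) 1) =
        Nat.card (D.transverse (Sum.inr q)))
    {d : Finset (HeightOneSpectrum (𝓞 ℚ))} (hd : D.IsLevel d) (hv₀d : v₀ ∉ d)
    (hbot : (D.atLevel (W.kummerSelmerStructure ((p : ℤ) ^ k * (p : ℤ))) d).selmerGroup = ⊥) :
    (inv.dualSelmerStructure (W.torsionGaloisModule ((p : ℤ) ^ k * (p : ℤ)))
        (D.atLevel (propagatedSelmerStructure W p k) d)).selmerGroup = ⊥ ∧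
      Nat.card (D.atLevel (propagatedSelmerStructure W p k) d).selmerGroup = p ^ (k + 1) ∧
      ∀ r : ZMod (p ^ (k + 1)), ∃ x ∈ (D.atLevel (propagatedSelmerStructure W p k) d).selmerGroup,
        Λ (galoisCohomology.localization _ (Sum.inr v₀) 1 x) = r := by
  haveI : NeZero (p ^ (k + 1)) := ⟨pow_ne_zero _ hp.out.ne_zero⟩
  set H := (D.atLevel (propagatedSelmerStructure W p k) d).selmerGroup with hH
  set Hs := (inv.dualSelmerStructure (W.torsionGaloisModule ((p : ℤ) ^ k * (p : ℤ)))
    (D.atLevel (propagatedSelmerStructure W p k) d)).selmerGroup with hHs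
  -- the count at the level `d`
  have hcount := DeepLedger.natCard_selmerGroup_propagated_atLevel_eq W p k hp2 hv₀ Λ hon hker inv hperf
    hsum hcompl hinj hEP T hv₀T hT h𝓕T h𝓚T D hPS hUT hd
  -- `Λ ∘ loc` restricted to `H` is injective (file 2 §5)
  let f : H → ZMod (p ^ (k + 1)) := fun x => Λ (galoisCohomology.localization _ (Sum.inr v₀) 1 x.1)
  have hf0 := localization_injOn_atLevel_of_kummer_atLevel_eq_bot W p k hp2 hv₀ Λ hker D hv₀d hbot
  have hfinj : Injective f := by
    intro x y hxy
    apply Subtype.ext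
    have hsub : Λ (galoisCohomology.localization _ (Sum.inr v₀) 1 (x.1 - y.1)) = 0 := by
      rw [map_sub, map_sub]
      exact sub_eq_zero.2 hxy
    exact sub_eq_zero.1 (hf0 _ (sub_mem x.2 y.2) hsub)
  haveI : Finite H := Finite.of_injective f hfinj
  have hle : Nat.card H ≤ p ^ (k + 1) := by
    have := Nat.card_le_card_of_injective f hfinj
    rwa [Nat.card_zmod] at this
  -- hence `#H^* = 1` and `#H = p^{k+1}`
  have hH1 : 1 ≤ Nat.card H := Nat.one_le_iff_ne_zero.2 Nat.card_pos.ne'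
  have hHs1 : Nat.card Hs = 1 := by
    have h1 : p ^ (k + 1) * Nat.card Hs ≤ p ^ (k + 1) * 1 := by rw [mul_one, ← hcount]; exact hle
    have h2 : Nat.card Hs ≤ 1 := Nat.le_of_mul_le_mul_left h1 (pow_pos hp.out.pos _)
    have h3 : Nat.card Hs ≠ 0 := by
      intro h0
      rw [h0, mul_zero] at hcount
      exact (Nat.card_pos (α := H)).ne' hcount
    omega
  have hHcard : Nat.card H = p ^ (k + 1) := by rw [hcount, hHs1, mul_one]
  haveI : Finite Hs := Nat.finite_of_card_ne_zero (by rw [hHs1]; exact one_ne_zero)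
  refine ⟨AddSubgroup.eq_bot_of_card_eq Hs hHs1, hHcard, fun r => ?_⟩
  -- `f` is a bijection `H → ℤ/p^{k+1}`
  have hbij : Bijective f := hfinj.bijective_of_nat_card_le (by rw [Nat.card_zmod, hHcard])
  obtain ⟨x, hx⟩ := hbij.2 r
  exact ⟨x.1, x.2, hx⟩

end DepthCore

end Summit.BirchSwinnertonDyer.BirchSwinnertonDyer.Theorems.KimAtThreeShallowEqDeepGoodCoreVertex

end
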